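import Mathlib.Analysis.SpecialFunctions.Pow.Real
import HarnessLib

/-!
# Majority gluing at `|A| = 6` from van den Berg–Kahn log-supermodularity — the abstract optimisation
# (lane prim-rate, constants-miner 1, row M1-V6)

Support file for the closed crux `NoHeavyLowerTail` (stmt-CriticalPhenomena-4575).  Pure real-inequality content of the `|A| = 6` bound
`PercNearOneGluingNoHeavyLowerTailMajorityGluingSix.lean`: if `f` is a log-supermodular, monotone set function on the subsets of four
relays with `f({b}) ≤ δ` (singles), `f` of pairs `p`, of triples `t`, of all four `q`, then `t₁ + t₂ + t₃ + t₄ − 3q ≤ (256/243)·δ`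
(`threeOfFour_sym`; the instances of log-supermodularity used are `tᵢ tⱼ ≤ p_{S_i ∩ S_j} q` and `p_P p_P' ≤ δ t` for pairs inside a triple).
The constant `256/243` is sharp for these hypotheses (law 'rare trigger × independent cuts with probability 8/9': `p = (8/9)δ`,
`t = (8/9)²δ`, `q = (8/9)³δ`).  Proof: choose the largest triple `x`, bound the others through the log-supermodularity instances, and reduce
every case to the cubic `4 m² δ − 3 m³ ≤ (256/243) δ³` with `m² = δ x`.  No definitions, no named facts, no sorries. [folklore]
-/

noncomputable section

namespace Summit.CriticalPhenomena.PercolationContinuityZ3.Theorems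

namespace HubOnly

/-! ### The abstract optimisation -/

/-- The cubic bound `4 m² δ − 3 m³ ≤ (256/243) δ³` for `0 ≤ m`, `0 ≤ δ`:
`(256/243) δ³ − 4 m² δ + 3 m³ = 3 (m − 8δ/9)² (m + 4δ/9)` (the value `256/243` is attained at `m = 8δ/9`). [folklore] -/
theorem cubic_bound (m δ : ℝ) (hm : 0 ≤ m) (hδ : 0 ≤ δ) :
    4 * m ^ 2 * δ - 3 * m ^ 3 ≤ 256 / 243 * δ ^ 3 := by
  have h := mul_nonneg (mul_nonneg (by norm_num : (0:ℝ) ≤ 3) (sq_nonneg (m - 8 / 9 * δ)))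
    (by linarith : 0 ≤ m + 4 / 9 * δ)
  have e : 3 * (m - 8 / 9 * δ) ^ 2 * (m + 4 / 9 * δ) = 256 / 243 * δ ^ 3 - (4 * m ^ 2 * δ - 3 * m ^ 3) := by
    ring
  linarith

/-- The abstract three-of-four bound, auxiliary form with `lc` the largest of the three pair values (see `threeOfFour_abstract`). [folklore] -/
theorem threeOfFour_aux (δ x q ta tb tc la lb lc : ℝ)
    (hq0 : 0 ≤ q) (hqa : q ≤ ta) (_hqb : q ≤ tb) (_hqc : q ≤ tc)
    (hax : ta ≤ x) (hbx : tb ≤ x) (hcx : tc ≤ x)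
    (hxa : x ≤ la) (hxb : x ≤ lb) (hxc : x ≤ lc) (haδ : la ≤ δ) (_hbδ : lb ≤ δ) (hcδ : lc ≤ δ)
    (hAa : x * ta ≤ la * q) (hAb : x * tb ≤ lb * q) (hAc : x * tc ≤ lc * q)
    (hBac : la * lc ≤ δ * x) (hBbc : lb * lc ≤ δ * x)
    (hla : la ≤ lc) (hlb : lb ≤ lc) :
    x + ta + tb + tc - 3 * q ≤ 256 / 243 * δ := by
  have hx0 : 0 ≤ x := le_trans hq0 (hqa.trans hax)
  have hδ0 : 0 ≤ δ := hx0.trans (hxa.trans haδ)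
  have hxδ : x ≤ δ := hxa.trans haδ
  rcases eq_or_lt_of_le hx0 with hx | hx
  · -- x = 0: everything vanishes
    have h1 : ta ≤ 0 := by rw [hx]; exact hax
    have h2 : tb ≤ 0 := by rw [hx]; exact hbx
    have h3 : tc ≤ 0 := by rw [hx]; exact hcx
    have h4 : x = 0 := hx.symm
    linarith
  -- x > 0; m := √(δ x)
  have hδpos : 0 < δ := lt_of_lt_of_le hx hxδ
  obtain ⟨m, hm0, hm2⟩ : ∃ m : ℝ, 0 ≤ m ∧ m ^ 2 = δ * x :=
    ⟨Real.sqrt (δ * x), Real.sqrt_nonneg _, Real.sq_sqrt (mul_nonneg hδ0 hx0)⟩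
  have hmpos : 0 < m := by
    rcases eq_or_lt_of_le hm0 with h | h
    · exfalso
      rw [← h] at hm2
      have h1 : 0 < δ * x := mul_pos hδpos hx
      have h2 : δ * x = 0 := by rw [← hm2]; norm_num
      linarith
    · exact h
  have two_ne : (2 : ℕ) ≠ 0 := by norm_num
  have hxm : x ≤ m := by
    refine (pow_le_pow_iff_left₀ hx0 hm0 two_ne).1 ?_
    rw [hm2, sq]; exact mul_le_mul_of_nonneg_right hxδ hx0
  have hmδ : m ≤ δ := by
    refine (pow_le_pow_iff_left₀ hm0 hδ0 two_ne).1 ?_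
    rw [hm2, sq]; exact mul_le_mul_of_nonneg_left hxδ hδ0
  have hla0 : 0 ≤ la := hx0.trans hxa
  have hlb0 : 0 ≤ lb := hx0.trans hxb
  have hlam : la ≤ m := by
    refine (pow_le_pow_iff_left₀ hla0 hm0 two_ne).1 ?_
    rw [hm2, sq]; exact (mul_le_mul_of_nonneg_left hla hla0).trans hBac
  have hlbm : lb ≤ m := by
    refine (pow_le_pow_iff_left₀ hlb0 hm0 two_ne).1 ?_
    rw [hm2, sq]; exact (mul_le_mul_of_nonneg_left hlb hlb0).trans hBbc
  have hh0 : 0 < lc := lt_of_lt_of_le hx hxc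
  have hqx : q ≤ x := hqa.trans hax
  have hcub := cubic_bound m δ hm0 hδ0
  -- the universal bound: δ² F ≤ 4 m² δ − 3 m³ gives F ≤ B
  have hfin : ∀ F : ℝ, δ * F ≤ 4 * δ * x - 3 * x * m → F ≤ 256 / 243 * δ := by
    intro F hF
    have h1 : δ * (δ * F) ≤ δ * (4 * δ * x - 3 * x * m) := mul_le_mul_of_nonneg_left hF hδ0
    have h2 : δ * (4 * δ * x - 3 * x * m) = 4 * m ^ 2 * δ - 3 * m ^ 3 := by
      linear_combination (-(4 * δ - 3 * m)) * hm2
    have h3 : δ * (δ * F) ≤ 256 / 243 * δ ^ 3 := by linarith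
    have h4 : δ * (δ * F) = δ ^ 2 * F := by ring
    have h5 : 256 / 243 * δ ^ 3 = δ ^ 2 * (256 / 243 * δ) := by ring
    rw [h4, h5] at h3
    exact le_of_mul_le_mul_left h3 (by positivity)
  have htriv : x ≤ 256 / 243 * δ := by linarith
  -- δ·t ≤ δ·x for the three triples
  have hdta : δ * ta ≤ δ * x := mul_le_mul_of_nonneg_left hax hδ0
  have hdtb : δ * tb ≤ δ * x := mul_le_mul_of_nonneg_left hbx hδ0
  have hdtc : δ * tc ≤ δ * x := mul_le_mul_of_nonneg_left hcx hδ0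
  by_cases hcase : m ≤ lc
  · -- Case I: lc ≥ m.  Bounds: lc·ta ≤ δ q, lc·tb ≤ δ q, x·tc ≤ lc q.
    have hta : lc * ta ≤ δ * q := by
      have s1 := mul_le_mul_of_nonneg_left hAa hh0.le
      have s2 := mul_le_mul_of_nonneg_left hBac hq0
      have h1 : x * (lc * ta) ≤ x * (δ * q) := by linarith
      exact le_of_mul_le_mul_left h1 hx
    have htb : lc * tb ≤ δ * q := by
      have s1 := mul_le_mul_of_nonneg_left hAb hh0.le
      have s2 := mul_le_mul_of_nonneg_left hBbc hq0
      have h1 : x * (lc * tb) ≤ x * (δ * q) := by linarith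
      exact le_of_mul_le_mul_left h1 hx
    have hxmlc : x * m ≤ x * lc := mul_le_mul_of_nonneg_left hcase hx0
    -- the key factor (lc − m)(2δ(lc+m) − 3 m lc) ≥ 0
    have hfac : 0 ≤ (lc - m) * (2 * δ * (lc + m) - 3 * m * lc) := by
      apply mul_nonneg (by linarith)
      have e1 : m * lc ≤ m * δ := mul_le_mul_of_nonneg_left hcδ hm0
      have e2 : m * lc ≤ δ * lc := mul_le_mul_of_nonneg_right hmδ hh0.le
      have e3 : 0 ≤ δ * m := mul_nonneg hδ0 hm0
      linarith
    -- from `lc² F ≤ 2x lc² + 2δx² − 3 lc x²` conclude `F ≤ B`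
    have hVW : ∀ F : ℝ, lc ^ 2 * F ≤ 2 * x * lc ^ 2 + 2 * δ * x ^ 2 - 3 * lc * x ^ 2 →
        F ≤ 256 / 243 * δ := by
      intro F hF
      apply hfin
      have h1 : δ * (2 * x * lc ^ 2 + 2 * δ * x ^ 2 - 3 * lc * x ^ 2) ≤ lc ^ 2 * (4 * δ * x - 3 * x * m) := by
        have e : lc ^ 2 * (4 * δ * x - 3 * x * m) - δ * (2 * x * lc ^ 2 + 2 * δ * x ^ 2 - 3 * lc * x ^ 2)
            = x * ((lc - m) * (2 * δ * (lc + m) - 3 * m * lc)) := by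
          have : δ * x = m ^ 2 := hm2.symm
          linear_combination (x * (3 * lc - 2 * δ)) * this
        have e2 := mul_nonneg hx0 hfac
        linarith
      have h2 : δ * (lc ^ 2 * F) ≤ lc ^ 2 * (4 * δ * x - 3 * x * m) :=
        le_trans (mul_le_mul_of_nonneg_left hF hδ0) h1
      have h3 : lc ^ 2 * (δ * F) ≤ lc ^ 2 * (4 * δ * x - 3 * x * m) := by linarith
      exact le_of_mul_le_mul_left h3 (by positivity)
    by_cases h3 : x * lc ≤ δ * q
    · -- (iii) q ≥ x lc/δ: F ≤ 4x − 3q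
      apply hfin
      linarith
    have h3' : δ * q ≤ x * lc := (not_le.1 h3).le
    by_cases h2 : x ^ 2 ≤ lc * q
    · -- (ii) x²/lc ≤ q ≤ x lc/δ
      have hlctc : lc * tc ≤ lc * x := mul_le_mul_of_nonneg_left hcx hh0.le
      have hF : lc * (x + ta + tb + tc - 3 * q) ≤ 2 * lc * x + q * (2 * δ - 3 * lc) := by linarith
      by_cases hs : 0 ≤ 2 * δ - 3 * lc
      · apply hfin
        have h4 : δ * q * (2 * δ - 3 * lc) ≤ x * lc * (2 * δ - 3 * lc) := mul_le_mul_of_nonneg_right h3' hs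
        have h5 := mul_le_mul_of_nonneg_left hF hδ0
        have h6 := mul_le_mul_of_nonneg_left hxmlc hh0.le
        have h7 : lc * (δ * (x + ta + tb + tc - 3 * q)) ≤ lc * (4 * δ * x - 3 * x * m) := by linarith
        exact le_of_mul_le_mul_left h7 hh0
      · have hs' : 2 * δ - 3 * lc ≤ 0 := (not_le.1 hs).le
        apply hVW
        have h4 : lc * q * (2 * δ - 3 * lc) ≤ x ^ 2 * (2 * δ - 3 * lc) := mul_le_mul_of_nonpos_right h2 hs'
        have h5 := mul_le_mul_of_nonneg_left hF hh0.le
        linarith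
    · -- (i) q ≤ x²/lc
      have h2' : lc * q ≤ x ^ 2 := (not_le.1 h2).le
      have s1 := mul_le_mul_of_nonneg_left hta hx0
      have s2 := mul_le_mul_of_nonneg_left htb hx0
      have s3 := mul_le_mul_of_nonneg_left hAc hh0.le
      have hF : x * lc * (x + ta + tb + tc - 3 * q) ≤ x ^ 2 * lc + q * (lc ^ 2 + 2 * x * δ - 3 * x * lc) := by
        linarith
      by_cases hs : 0 ≤ lc ^ 2 + 2 * x * δ - 3 * x * lc
      · apply hVW
        have h4 : lc * q * (lc ^ 2 + 2 * x * δ - 3 * x * lc) ≤ x ^ 2 * (lc ^ 2 + 2 * x * δ - 3 * x * lc) :=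
          mul_le_mul_of_nonneg_right h2' hs
        have h5 := mul_le_mul_of_nonneg_left hF hh0.le
        have h6 : x * (lc ^ 2 * (x + ta + tb + tc - 3 * q)) ≤ x * (2 * x * lc ^ 2 + 2 * δ * x ^ 2 - 3 * lc * x ^ 2) := by
          linarith
        exact le_of_mul_le_mul_left h6 hx
      · have hs' : lc ^ 2 + 2 * x * δ - 3 * x * lc ≤ 0 := (not_le.1 hs).le
        have h4 : q * (lc ^ 2 + 2 * x * δ - 3 * x * lc) ≤ 0 := mul_nonpos_iff.2 (Or.inl ⟨hq0, hs'⟩)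
        have h5 : x * lc * (x + ta + tb + tc - 3 * q) ≤ x * lc * x := by linarith
        have h6 : x + ta + tb + tc - 3 * q ≤ x := le_of_mul_le_mul_left h5 (by positivity)
        linarith
  · -- Case II: all three pairs ≤ m
    have hlcm : lc ≤ m := (not_le.1 hcase).le
    have s1 := mul_le_mul_of_nonneg_right hlam hq0
    have s2 := mul_le_mul_of_nonneg_right hlbm hq0
    have s3 := mul_le_mul_of_nonneg_right hlcm hq0
    have hA : x * (ta + tb + tc) ≤ 3 * m * q := by linarith
    apply hfin
    by_cases h2 : x ^ 2 ≤ m * q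
    · -- q ≥ x²/m: F ≤ 4x − 3q and 3 x m ≤ 3 δ q
      have e1 : δ * x ^ 2 ≤ δ * (m * q) := mul_le_mul_of_nonneg_left h2 hδ0
      have e2 : δ * x ^ 2 = m * (x * m) := by linear_combination x * hm2.symm
      have e3 : m * (x * m) ≤ m * (δ * q) := by linarith
      have e4 : x * m ≤ δ * q := le_of_mul_le_mul_left e3 hmpos
      linarith
    · have h2' : m * q ≤ x ^ 2 := (not_le.1 h2).le
      have hmx : 0 ≤ m - x := sub_nonneg.2 hxm
      have h4 : m * q * (m - x) ≤ x ^ 2 * (m - x) := mul_le_mul_of_nonneg_right h2' hmx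
      have h5 : x * (x + ta + tb + tc - 3 * q) ≤ x ^ 2 + 3 * (q * (m - x)) := by linarith
      have h6 := mul_le_mul_of_nonneg_left h5 hm0
      have h7 : m * (x * (x + ta + tb + tc - 3 * q)) ≤ 4 * m * x ^ 2 - 3 * x ^ 3 := by linarith
      have h8 := mul_le_mul_of_nonneg_left h7 hδ0
      have e : δ * x ^ 3 = x ^ 2 * m ^ 2 := by rw [hm2]; ring
      have h9 : x * (m * (δ * (x + ta + tb + tc - 3 * q))) ≤ x * (m * (4 * δ * x - 3 * x * m)) := by linarith
      have h10 := le_of_mul_le_mul_left h9 hx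
      exact le_of_mul_le_mul_left h10 hmpos

/-- **Abstract three-of-four bound** (prim-rate row M1-V6): if `0 ≤ q ≤ t_i ≤ x ≤ ℓ_i ≤ δ`, `x·t_i ≤ ℓ_i·q` (log-supermodularity between the
largest triple and the other three) and `ℓ_i ℓ_j ≤ δ x` (log-supermodularity between the pairs inside the largest triple), then
`x + t_a + t_b + t_c − 3q ≤ (256/243)·δ`.  Proof: with `m² = δ x`, every case reduces to `δ²·F ≤ 4 m² δ − 3 m³ ≤ (256/243) δ³`; the bound is
attained by the law 'rare trigger × independent cuts with probability 8/9'. [folklore] -/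
theorem threeOfFour_abstract (δ x q ta tb tc la lb lc : ℝ)
    (hq0 : 0 ≤ q) (hqa : q ≤ ta) (hqb : q ≤ tb) (hqc : q ≤ tc)
    (hax : ta ≤ x) (hbx : tb ≤ x) (hcx : tc ≤ x)
    (hxa : x ≤ la) (hxb : x ≤ lb) (hxc : x ≤ lc) (haδ : la ≤ δ) (hbδ : lb ≤ δ) (hcδ : lc ≤ δ)
    (hAa : x * ta ≤ la * q) (hAb : x * tb ≤ lb * q) (hAc : x * tc ≤ lc * q)
    (hBab : la * lb ≤ δ * x) (hBac : la * lc ≤ δ * x) (hBbc : lb * lc ≤ δ * x) :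
    x + ta + tb + tc - 3 * q ≤ 256 / 243 * δ := by
  rcases le_total la lc with h1 | h1
  · rcases le_total lb lc with h2 | h2
    · exact threeOfFour_aux δ x q ta tb tc la lb lc hq0 hqa hqb hqc hax hbx hcx hxa hxb hxc haδ hbδ hcδ
        hAa hAb hAc hBac hBbc h1 h2
    · -- lb is the largest
      have := threeOfFour_aux δ x q ta tc tb la lc lb hq0 hqa hqc hqb hax hcx hbx hxa hxc hxb haδ hcδ hbδ
        hAa hAc hAb hBab (by rw [mul_comm]; exact hBbc) (h1.trans h2) h2
      linarith
  · rcases le_total lb la with h2 | h2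
    · -- la is the largest
      have := threeOfFour_aux δ x q tc tb ta lc lb la hq0 hqc hqb hqa hcx hbx hax hxc hxb hxa hcδ hbδ haδ
        hAc hAb hAa (by rw [mul_comm]; exact hBac) (by rw [mul_comm]; exact hBab) h1 h2
      linarith
    · -- lb ≥ la ≥ lc: lb largest
      have := threeOfFour_aux δ x q ta tc tb la lc lb hq0 hqa hqc hqb hax hcx hbx hxa hxc hxb haδ hcδ hbδ
        hAa hAc hAb hBab (by rw [mul_comm]; exact hBbc) h2 (h1.trans h2)
      linarith


/-- One of four reals is the largest. [folklore] -/
theorem exists_max_four (a b c d : ℝ) :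
    (b ≤ a ∧ c ≤ a ∧ d ≤ a) ∨ (a ≤ b ∧ c ≤ b ∧ d ≤ b) ∨ (a ≤ c ∧ b ≤ c ∧ d ≤ c) ∨ (a ≤ d ∧ b ≤ d ∧ c ≤ d) := by
  rcases le_total b a with h1 | h1 <;> rcases le_total c d with h2 | h2 <;> rcases le_total a d with h3 | h3 <;>
    rcases le_total b d with h4 | h4 <;> rcases le_total a c with h5 | h5 <;> rcases le_total b c with h6 | h6 <;>
    first
    | exact Or.inl ⟨by linarith, by linarith, by linarith⟩
    | exact Or.inr (Or.inl ⟨by linarith, by linarith, by linarith⟩)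
    | exact Or.inr (Or.inr (Or.inl ⟨by linarith, by linarith, by linarith⟩))
    | exact Or.inr (Or.inr (Or.inr ⟨by linarith, by linarith, by linarith⟩))

/-- **Symmetric abstract three-of-four bound.**  Four "triple" values `t₁..t₄` (`tᵢ` = all but `i` cut), six "pair" values `p_kl`, the
"all four" value `q` and a bound `δ` on the singles; hypotheses = the log-supermodularity instances (A) `tᵢ tⱼ ≤ p_{kl} q` (`{i,j,k,l} = {1,2,3,4}`)
and (B) `p_P p_P' ≤ δ tᵢ` for the pairs `P ≠ P'` inside the triple `i`, plus monotonicity.  Conclusion: `t₁ + t₂ + t₃ + t₄ − 3q ≤ (256/243) δ`. [folklore] -/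
theorem threeOfFour_sym (δ q t1 t2 t3 t4 p12 p13 p14 p23 p24 p34 : ℝ)
    (hq0 : 0 ≤ q) (hq1 : q ≤ t1) (hq2 : q ≤ t2) (hq3 : q ≤ t3) (hq4 : q ≤ t4)
    (h1a : t1 ≤ p23) (h1b : t1 ≤ p24) (h1c : t1 ≤ p34)
    (h2a : t2 ≤ p13) (h2b : t2 ≤ p14) (h2c : t2 ≤ p34)
    (h3a : t3 ≤ p12) (h3b : t3 ≤ p14) (h3c : t3 ≤ p24)
    (h4a : t4 ≤ p12) (h4b : t4 ≤ p13) (h4c : t4 ≤ p23)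
    (d12 : p12 ≤ δ) (d13 : p13 ≤ δ) (d14 : p14 ≤ δ) (d23 : p23 ≤ δ) (d24 : p24 ≤ δ) (d34 : p34 ≤ δ)
    (A12 : t1 * t2 ≤ p34 * q) (A13 : t1 * t3 ≤ p24 * q) (A14 : t1 * t4 ≤ p23 * q)
    (A23 : t2 * t3 ≤ p14 * q) (A24 : t2 * t4 ≤ p13 * q) (A34 : t3 * t4 ≤ p12 * q)
    (B1a : p23 * p24 ≤ δ * t1) (B1b : p23 * p34 ≤ δ * t1) (B1c : p24 * p34 ≤ δ * t1)
    (B2a : p13 * p14 ≤ δ * t2) (B2b : p13 * p34 ≤ δ * t2) (B2c : p14 * p34 ≤ δ * t2)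
    (B3a : p12 * p14 ≤ δ * t3) (B3b : p12 * p24 ≤ δ * t3) (B3c : p14 * p24 ≤ δ * t3)
    (B4a : p12 * p13 ≤ δ * t4) (B4b : p12 * p23 ≤ δ * t4) (B4c : p13 * p23 ≤ δ * t4) :
    t1 + t2 + t3 + t4 - 3 * q ≤ 256 / 243 * δ := by
  rcases exists_max_four t1 t2 t3 t4 with ⟨h2, h3, h4⟩ | ⟨h1, h3, h4⟩ | ⟨h1, h2, h4⟩ | ⟨h1, h2, h3⟩
  · -- t1 largest: others (t2,t3,t4), pairs la = p34, lb = p24, lc = p23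
    have := threeOfFour_abstract δ t1 q t2 t3 t4 p34 p24 p23 hq0 hq2 hq3 hq4 h2 h3 h4 h1c h1b h1a d34 d24 d23
      A12 A13 A14 (by rw [mul_comm]; exact B1c) (by rw [mul_comm]; exact B1b) (by rw [mul_comm]; exact B1a)
    linarith
  · -- t2 largest: others (t1,t3,t4), pairs p34, p14, p13
    have := threeOfFour_abstract δ t2 q t1 t3 t4 p34 p14 p13 hq0 hq1 hq3 hq4 h1 h3 h4 h2c h2b h2a d34 d14 d13
      (by rw [mul_comm]; exact A12) A23 A24 (by rw [mul_comm]; exact B2c) (by rw [mul_comm]; exact B2b) (by rw [mul_comm]; exact B2a)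
    linarith
  · -- t3 largest: others (t1,t2,t4), pairs p24, p14, p12
    have := threeOfFour_abstract δ t3 q t1 t2 t4 p24 p14 p12 hq0 hq1 hq2 hq4 h1 h2 h4 h3c h3b h3a d24 d14 d12
      (by rw [mul_comm]; exact A13) (by rw [mul_comm]; exact A23) A34 (by rw [mul_comm]; exact B3c) (by rw [mul_comm]; exact B3b) (by rw [mul_comm]; exact B3a)
    linarith
  · -- t4 largest: others (t1,t2,t3), pairs p23, p13, p12
    have := threeOfFour_abstract δ t4 q t1 t2 t3 p23 p13 p12 hq0 hq1 hq2 hq3 h1 h2 h3 h4c h4b h4a d23 d13 d12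
      (by rw [mul_comm]; exact A14) (by rw [mul_comm]; exact A24) (by rw [mul_comm]; exact A34)
      (by rw [mul_comm]; exact B4c) (by rw [mul_comm]; exact B4b) (by rw [mul_comm]; exact B4a)
    linarith


end HubOnly

end Summit.CriticalPhenomena.PercolationContinuityZ3.Theorems

end
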